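import Literature.AlgebraicGeometry.HodgeTheory.AbelianLowDimensionWeilReductionProofs
import Literature.AlgebraicGeometry.HodgeTheory.LefschetzOneOneHolds
import Literature.AlgebraicGeometry.HodgeTheory.UnitaryTwoOneTimesCMCurveWeilClasses
import Literature.AlgebraicGeometry.HodgeTheory.SimpleThreefoldCMEmbeddingCaseF
import Literature.AlgebraicGeometry.HodgeTheory.AbelianFourfoldsStablyNondegenerate
import Literature.AlgebraicGeometry.Motives.AbelianVarietySimpleFactorsUnique
import HarnessLib

/-!
# `B²(X) ⊆ D²(X) + Σ_K W_K` pointwise: the codimension-2 conclusion of Moonen–Zarhin's Thm. 0.1 as a predicate on one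
# complex abelian variety, its isogeny invariance, and the NON-CM NON-SIMPLE fourfolds (Thm. 0.1 (1) case (a1), (4))

Ring 2 literature lane (cell `pub-hodge-ring2`, lit gen 64, programme R37). HONEST FRAMING (cell, verbatim): research
route conditional on HC_CM; not a corollary; Q11.4-sentence-2 already refuted in dim ≥ 3. `HC_CM` does not occur in this
file; Markman's fourfold theorem occurs only as the HYPOTHESIS `Markman2025_weilClasses_algebraic_abelianFourfold` of
§1's last theorem. One definition with body (a predicate), theorems; no named fact, no `sorry`.

THE PRINT. B. Moonen, Yu. Zarhin, *Hodge classes on abelian varieties of low dimension*, Math. Ann. **315** (1999)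
711–733 [held: `paper:arxiv-math_9901113`], Thm. 0.1: «Let `X` be a complex abelian variety with `dim(X) ≤ 4`. […]
(1) Suppose we are in case (a) or (b). Then the Hodge ring `B•(X)` is generated by the subalgebra `D•(X)` of divisor
classes together with the space of Weil classes `W_k ⊂ B²(X)`. […] (4) Suppose we are not in one of the cases (a), (b),
(c) or (d). Then […] `B•(Xⁿ) = D•(Xⁿ)` for all `n`» (chunk p0001), where «(a) The abelian variety `X` is isogenous to a
product `X₁ × X₂` where `X₁` is an elliptic curve with complex multiplication by an imaginary quadratic field `k` and
where `X₂` is a simple abelian threefold such that there exists an embedding `k ↪ End⁰(X₂)`»; §5 (5.1): «Up to isogeny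
we can decompose `X` …»; (5.3): «Either (a1) `F = k`, or (a2) `F` is a sextic CM-field» (`F = End⁰(X₂)`), and for
(a1) «`Hg(X) = {(u₁,u₂) ∈ U_k × U_k(V_{X₂},ψ_{X₂}) ∣ u₁ · det_k(u₂) = 1}` … The space of Weil classes `W_k` is a
subspace of `H¹(X₁,ℚ) ⊗ H³(X₂,ℚ)`» (chunk p0009); (5.4): non-simple `X` not of CM type outside (a).

THE TREE'S NAMED FACT `MoonenZarhin1999_codimTwoHodgeClasses_abelianFourfold`
(`HodgeTheory/AbelianLowDimensionCodimTwoHodgeClasses`) is the codimension-`2` part of Thm. 0.1 for ALL fourfolds: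
every rational `(2,2)`-class lies in `D²(A) ⊗ ℂ ⊔ span_ℂ {rational (2,2) Weil classes of (A, φ, d), φ ≫ φ = -d}`.
This file types that conclusion AT ONE `A` as the predicate `IsCodimTwoDivisorWeilGenerated A` (same body, `A` free;
the fact is `∀ A, dim A = 4 → IsCodimTwoDivisorWeilGenerated A` by `Iff.rfl`), so that the rows of Thm. 0.1 the tree
has PROVED can be recorded against the fact one isogeny class at a time:

* §1 `IsDivisorGenerated.isCodimTwoDivisorWeilGenerated` (`B = D`, e.g. every stably nondegenerate `A`: Thm. 0.1 (4)),
  `IsDivisorWeilGenerated.isCodimTwoDivisorWeilGenerated_of_isWeilType` (`B = D + W_K` of a Weil-type pair `(A, φ)`,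
  van Geemen 6.12's conclusion: the Weil plane is the complex span of its rational classes, all of type `(2,2)`), and
  **`IsCodimTwoDivisorWeilGenerated.hodgeConjectureFor_of_markman`** — for a FOURFOLD, the predicate plus Markman's
  theorem (hypothesis) give the Hodge conjecture (Lefschetz `(1,1)`, the tree's `mem_algebraicClasses_two_of_dim_eq_four`,
  hard Lefschetz `nonempty_hardLefschetzNFold_holds`) — the pointwise form of the tree's reduction
  `MoonenZarhin1999_hodgeClasses_abelian_dim_le_five_of_weilClassesFourfolds_of_printed`.
* §2 **ISOGENY INVARIANCE** `IsCodimTwoDivisorWeilGenerated.of_isIsogeny` / `.of_isIsogeny'` / `.of_isIsogenous` /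
  `isCodimTwoDivisorWeilGenerated_iff_of_isIsogenous` («Up to isogeny we can decompose `X`», (5.1); van Geemen 3.6–3.7:
  `f^*` is a ring isomorphism `B•(B) ≅ B•(A)` matching `D•` and, for the transported structure `f φ g`, the Weil planes —
  the tree's `map_mem_divisorClassesSpan`, `map_mem_weilClassesOf_of_comm`, `conj_comp_conj`,
  `complexBetti_map_map_of_comp_eq_nsmul_id`).
* §3 **CASE (a1)**: `isCodimTwoDivisorWeilGenerated_prod_cmCurve_of_unitaryTwoOne` (the tree's R30 theorem
  `isDivisorWeilGenerated_prod_cmCurve_of_unitaryTwoOne` — `B•(T × E_k) ⊆ D• + W_k` for `T` a threefold with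
  `dim_ℚ End⁰(T) = 2` — read through §1), `…_of_isIsogenous_unitaryTwoOne_prod_cmCurve`, and with the LITERAL
  hypotheses of (a): **`isCodimTwoDivisorWeilGenerated_cmCurve_prod_simpleThreefold_of_not_isOfCMType`** (`E` an
  elliptic curve with `χ ≫ χ = -d`, `T` a simple threefold NOT of CM type, `j : End⁰(E) →+* End⁰(T)`; the data of R30 are
  PRODUCED from `j` as in the Summit file `Ring2/LowDimensionHodgeOfMarkman` §2: honest `φ` with `φ ≫ φ = -(M²d)`
  (`exists_hom_comp_self_eq_neg_of_ringHom`), Shimura multiplicities `{1,2}`, matched sign, `dim_ℚ End⁰(T) = 2` by (5.3)),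
  `isCodimTwoDivisorWeilGenerated_of_isIsogenous_caseA_of_not_isOfCMType`.
* §4 **EVERY NON-SIMPLE COMPLEX ABELIAN FOURFOLD NOT OF CM TYPE satisfies `B² ⊆ D² + Σ_K W_K` — UNCONDITIONALLY**:
  `isCodimTwoDivisorWeilGenerated_of_dim_eq_four_of_not_isSimple_of_not_isOfCMType` (outside (a): Thm. 0.1 (4) = the
  tree's `isStablyNondegenerate_of_dim_eq_four_of_not_isSimple_of_not_isOfCMType'`, (5.4); in (a) with `T` not CM: §3);
  with Markman's theorem as hypothesis, the Hodge conjecture for these fourfolds (§1).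

What is NOT here: the CM fourfolds (case (a2) and the CM products — Summit-side, CorCM's
`CMWeights.moonenZarhin_codimTwo_biproduct_cm` + §2, file `Summits/HodgeConjecture/Ring2/NonSimpleFourfoldsCodimTwo`);
the SIMPLE fourfolds (b)–(d)/(4) (Moonen–Zarhin 1995) — so the named fact is NOT discharged here; nothing on `B² ≠ D²`.

## References
* [MoonenZarhin1999LowDim] B. Moonen, Yu. Zarhin, Math. Ann. 315 (1999) 711–733, Thm. 0.1 (1), (4), (1.9), §5 (5.1),
  (5.3), (5.4).
* [vanGeemen1994HodgeAV] B. van Geemen, LNM 1594 (1994), 2.4, 3.6–3.7, 4.9, Lemma 5.2, Thm. 6.12.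
* [MumfordAV1970] D. Mumford, *Abelian Varieties* (1970), §19 Remark p. 169, Thm. 1 (pp. 173–174).
* [Markman2025SurveySecant] E. Markman, arXiv:2509.23403, Thm. 1.2, §1.1 and Cor. 1.3 (hypothesis only).
* [VoisinHodgeI2002] C. Voisin, *Hodge Theory and Complex Algebraic Geometry I*, Thm. 6.25, Thm. 11.30.
-/

noncomputable section

open CategoryTheory Module

namespace Literature.AlgebraicGeometry.HodgeTheory

open Literature.AlgebraicTopology.SingularHomology
open Literature.AlgebraicGeometry.Motives (AbelianVariety IsSmoothProjective)
open Literature.AlgebraicGeometry.Motives.AbelianVariety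
open Literature.AlgebraicGeometry.Milne1999 (IsOfCMType)
open Literature.Barriers.HodgeConjecture (divisorClassesSpan)
open Literature.AlgebraicGeometry.Deligne1982 (weilClassesOf_le_weilClassesOf_nsmul)

variable {A B X Y E T : AbelianVariety ℂ}

/-! ### §0 The predicate -/

/-- **`IsCodimTwoDivisorWeilGenerated A` — `B²(A) ⊆ D²(A) + Σ_K W_K` on the tree's real carriers**: every rational
class of Hodge type `(2,2)` in `H⁴(A(ℂ); ℂ)` lies in the span of the complexified products of divisor classes
`divisorClassesSpan A.X A.dim 2` and of the rational `(2,2)`-classes `w` of the Weil planes `weilClassesOf A φ 2 d`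
of the endomorphisms `φ : A ⟶ A` with `φ ≫ φ = -d`, `0 < d` (Moonen–Zarhin: «`B²(X) = D²(X) + Σ W_k`», the `W_k`
being the Weil classes of the imaginary quadratic fields `k = ℚ(√-d) ↪ End⁰(X)` acting with multiplicities `(2,2)`,
(1.9)). VERBATIM the body of the tree's named fact `MoonenZarhin1999_codimTwoHodgeClasses_abelianFourfold` with
the abelian variety free (that fact is `∀ A, A.dim = 4 → IsCodimTwoDivisorWeilGenerated A`,
`moonenZarhin1999_codimTwoHodgeClasses_abelianFourfold_iff`); a predicate (nothing asserted), meaningful in every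
dimension. [cite: MoonenZarhin1999LowDim, Thm. 0.1 with (1.4) and (1.9)] -/
def IsCodimTwoDivisorWeilGenerated (A : AbelianVariety ℂ) : Prop :=
  ∀ c : complexBetti A.X (2 * 2), IsRationalClass c → IsOfHodgeType A.dim A.X (2 * 2) 2 2 c →
    c ∈ divisorClassesSpan A.X A.dim 2 ⊔
      Submodule.span ℂ {w : complexBetti A.X (2 * 2) | ∃ (d : ℕ) (φ : A ⟶ A), 0 < d ∧
        φ ≫ φ = -(d • 𝟙 A) ∧ IsRationalClass w ∧ IsOfHodgeType A.dim A.X (2 * 2) 2 2 w ∧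
        w ∈ weilClassesOf A φ 2 d}

/-- Unfolding of `IsCodimTwoDivisorWeilGenerated`. [cite: MoonenZarhin1999LowDim, Thm. 0.1 with (1.4) and (1.9)] -/
theorem isCodimTwoDivisorWeilGenerated_iff (A : AbelianVariety ℂ) :
    IsCodimTwoDivisorWeilGenerated A ↔
      ∀ c : complexBetti A.X (2 * 2), IsRationalClass c → IsOfHodgeType A.dim A.X (2 * 2) 2 2 c →
        c ∈ divisorClassesSpan A.X A.dim 2 ⊔
          Submodule.span ℂ {w : complexBetti A.X (2 * 2) | ∃ (d : ℕ) (φ : A ⟶ A), 0 < d ∧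
            φ ≫ φ = -(d • 𝟙 A) ∧ IsRationalClass w ∧ IsOfHodgeType A.dim A.X (2 * 2) 2 2 w ∧
            w ∈ weilClassesOf A φ 2 d} :=
  Iff.rfl

/-- **The named fact `MoonenZarhin1999_codimTwoHodgeClasses_abelianFourfold` is `IsCodimTwoDivisorWeilGenerated` at
every fourfold** (definitional). [cite: MoonenZarhin1999LowDim, Thm. 0.1 with (1.4) and (1.9)] -/
theorem moonenZarhin1999_codimTwoHodgeClasses_abelianFourfold_iff :
    MoonenZarhin1999_codimTwoHodgeClasses_abelianFourfold ↔
      ∀ A : AbelianVariety ℂ, A.dim = 4 → IsCodimTwoDivisorWeilGenerated A :=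
  Iff.rfl

/-- The fact, granted as a hypothesis, gives the predicate at every fourfold. [cite: MoonenZarhin1999LowDim, Thm. 0.1] -/
theorem isCodimTwoDivisorWeilGenerated_of_dim_eq_four_of_fact (h : MoonenZarhin1999_codimTwoHodgeClasses_abelianFourfold)
    (hA : A.dim = 4) : IsCodimTwoDivisorWeilGenerated A :=
  h A hA

/-! ### §1 The rows `B = D` and `B = D + W_K`; the Hodge conjecture for a fourfold from the predicate and Markman -/

/-- **`B = D` gives `B² ⊆ D² + Σ W_K`** (the Weil summand is not needed). Thm. 0.1 (4): «`B•(Xⁿ) = D•(Xⁿ)`».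
[cite: MoonenZarhin1999LowDim, Thm. 0.1 (4)] [cite: vanGeemen1994HodgeAV, §2.4] -/
theorem IsDivisorGenerated.isCodimTwoDivisorWeilGenerated (h : IsDivisorGenerated A) :
    IsCodimTwoDivisorWeilGenerated A :=
  fun c hc hH => Submodule.mem_sup_left (h 2 c hc hH)

/-- A stably nondegenerate abelian variety (`B•(Aⁿ) = D•(Aⁿ)` for all `n`, Moonen–Zarhin's condition (D)) satisfies
`B² ⊆ D² + Σ W_K`. [cite: MoonenZarhin1999LowDim, Thm. 0.1 (4) and §2 condition (D)] -/
theorem IsStablyNondegenerate.isCodimTwoDivisorWeilGenerated (h : IsStablyNondegenerate A) :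
    IsCodimTwoDivisorWeilGenerated A :=
  h.isDivisorGenerated.isCodimTwoDivisorWeilGenerated

/-- **`B = D + W_K` for a Weil-type pair `(A, φ)` of type `(2, d)` gives `B² ⊆ D² + Σ W_K`**: the Weil plane
`weilClassesOf A φ 2 d` is the complex span of its rational classes (`weilClassesOf_eq_span_isRationalClass`, van
Geemen 4.9), each of type `(2,2)` under Weil type (`IsWeilType.isOfHodgeType_of_mem_weilClassesOf`, Lemma 5.2), so it
lies in the Weil summand of the predicate. [cite: MoonenZarhin1999LowDim, Thm. 0.1 (1) and (1.9)]
[cite: vanGeemen1994HodgeAV, 4.9 and Lemma 5.2 and Thm. 6.12] -/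
theorem IsDivisorWeilGenerated.isCodimTwoDivisorWeilGenerated_of_isWeilType {φ : A ⟶ A} {d : ℕ}
    (hW : IsWeilType A φ 2 d) (h : IsDivisorWeilGenerated A φ 2 d) : IsCodimTwoDivisorWeilGenerated A := by
  intro c hc hH
  obtain ⟨y, hy, z, hz, rfl⟩ := Submodule.mem_sup.1 (h.2 c hc hH)
  refine Submodule.add_mem_sup hy ?_
  rw [weilClassesOf_eq_span_isRationalClass hW.pos hW.dim_eq hW.d_pos hW.sq_eq] at hz
  refine Submodule.span_mono ?_ hz
  rintro w ⟨hwQ, hwW⟩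
  refine ⟨d, φ, hW.d_pos, hW.sq_eq, hwQ, ?_, hwW⟩
  rw [hW.dim_eq]
  exact hW.isOfHodgeType_of_mem_weilClassesOf hwW

/-- **THE HODGE CONJECTURE FOR A FOURFOLD WITH `B² ⊆ D² + Σ W_K`, GRANTED MARKMAN'S THEOREM ON THE WEIL CLASSES OF
ABELIAN FOURFOLDS** (the tree's named fact `Markman2025_weilClasses_algebraic_abelianFourfold`, a HYPOTHESIS here):
codimension `0` (`hodgeConjectureFor_codim_zero`), `1` (Lefschetz `(1,1)`, the tree's theorem
`lefschetzOneOne_rational_holds`), `2` (the tree's `mem_algebraicClasses_two_of_dim_eq_four`: divisor products are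
algebraic, the rational `(2,2)` Weil classes are algebraic by the hypothesis), `3, 4` (hard Lefschetz, the tree's
theorem `nonempty_hardLefschetzNFold_holds`, `mem_algebraicClasses_of_lt_of_nonempty`). The pointwise form of the
reduction «Thm. 0.1 + Markman ⟹ HC for abelian fourfolds» (Markman, Cor. 1.3).
[cite: MoonenZarhin1999LowDim, Thm. 0.1] [cite: Markman2025SurveySecant, §1.1 and Cor. 1.3]
[cite: VoisinHodgeI2002, Thm. 6.25 and Thm. 11.30] -/
theorem IsCodimTwoDivisorWeilGenerated.hodgeConjectureFor_of_markman
    (hMark : Markman2025_weilClasses_algebraic_abelianFourfold) (hA : A.dim = 4)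
    (h : IsCodimTwoDivisorWeilGenerated A) : HodgeConjectureFor A.dim A.X := by
  have hX : IsSmoothProjective A.dim A.X := AbelianVariety.isSmoothProjective_holds
  have h11 : ∀ b : complexBetti A.X (2 * 1), IsRationalClass b → IsOfHodgeType A.dim A.X (2 * 1) 1 1 b →
      b ∈ algebraicClasses A.X 1 := fun b hb hbb => lefschetzOneOne_rational_holds hX b hb hbb
  refine ⟨nonempty_hodgeModel_holds hX, fun p c hc hpp => ?_⟩
  -- the half `2q ≤ dim A`: codimension zero, Lefschetz `(1,1)`, and the codimension-`2` row
  have low : ∀ (q : ℕ) (c : complexBetti A.X (2 * q)), 2 * q ≤ A.dim → IsRationalClass c →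
      IsOfHodgeType A.dim A.X (2 * q) q q c → c ∈ algebraicClasses A.X q := by
    intro q c hq hc hqq
    have hq2 : q ≤ 2 := by omega
    interval_cases q
    · exact hodgeConjectureFor_codim_zero c
    · exact h11 c hc hqq
    · exact mem_algebraicClasses_two_of_dim_eq_four hMark A hA h11 (h c hc hqq)
  rcases Nat.lt_or_ge A.dim (2 * p) with hlt | hge
  · exact mem_algebraicClasses_of_lt_of_nonempty (nonempty_hardLefschetzNFold_holds _ _) hX hlt
      (fun c' hc' hpp' ↦ low (A.dim - p) c' (by omega) hc' hpp') c hc hpp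
  · exact low p c hge hc hpp

/-! ### §2 Isogeny invariance («Up to isogeny we can decompose `X`», (5.1); van Geemen 3.6–3.7) -/

/-- **`B² ⊆ D² + Σ W_K` PASSES TO THE SOURCE OF AN ISOGENY.** For an isogeny `f : A ⟶ B` with quasi-inverse `g`
(`f ≫ g = [N]_A`, `g ≫ f = [N]_B`, Mumford §19): a rational `(2,2)`-class `c` on `A` has `g^* c` rational of type
`(2,2)` on `B`, hence in `D²(B) ⊗ ℂ + span {w}`; pulling back by `f`, `f^*(D²(B) ⊗ ℂ) ⊆ D²(A) ⊗ ℂ`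
(`AbelianVariety.map_mem_divisorClassesSpan`), and a rational `(2,2)` Weil class `w ∈ W(B, φ, 2, d) ⊆ W(B, Nφ, 2, N²d)`
goes to a rational `(2,2)`-class of `W(A, f φ g, 2, N²d)` (`map_mem_weilClassesOf_of_comm` along
`f ≫ (N φ) = (f φ g) ≫ f`; `(f φ g)² = -N²d`, `conj_comp_conj`); finally `f^* g^* c = N⁴ c`. Van Geemen: «An isogeny
`φ : Y → X` thus induces isomorphisms `Bᵖ(X) → Bᵖ(Y)`», «`φ^* : H¹(X, ℚ) → H¹(Y, ℚ)` is an isomorphism of `K`-vector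
spaces». [cite: vanGeemen1994HodgeAV, 3.6–3.7 and proof of Lemma 5.2] [cite: MumfordAV1970, §19 Remark p. 169]
[cite: MoonenZarhin1999LowDim, §5 (5.1) and (1.9)] -/
theorem IsCodimTwoDivisorWeilGenerated.of_isIsogeny (hB : IsCodimTwoDivisorWeilGenerated B) {f : A ⟶ B}
    (hf : AbelianVariety.IsIsogeny f) : IsCodimTwoDivisorWeilGenerated A := by
  obtain ⟨g, N, hN, hfg, hgf⟩ := AbelianVariety.IsIsogeny.exists_nsmul_inverse_holds hf
  intro c hcQ hcH
  -- the class `g^* c` on `B` and its decomposition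
  have hc' := AbelianVariety.mapsTo_hodgeClasses g 2 ⟨hcQ, hcH⟩
  have hmem := hB _ hc'.1 hc'.2
  -- `f^*` maps the right-hand side at `B` into the right-hand side at `A`
  have hle : (divisorClassesSpan B.X B.dim 2 ⊔
      Submodule.span ℂ {w : complexBetti B.X (2 * 2) | ∃ (d : ℕ) (φ : B ⟶ B), 0 < d ∧
        φ ≫ φ = -(d • 𝟙 B) ∧ IsRationalClass w ∧ IsOfHodgeType B.dim B.X (2 * 2) 2 2 w ∧
        w ∈ weilClassesOf B φ 2 d}).map (complexBetti.map f.hom.hom.hom (2 * 2)).hom ≤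
      divisorClassesSpan A.X A.dim 2 ⊔
        Submodule.span ℂ {w : complexBetti A.X (2 * 2) | ∃ (d : ℕ) (φ : A ⟶ A), 0 < d ∧
          φ ≫ φ = -(d • 𝟙 A) ∧ IsRationalClass w ∧ IsOfHodgeType A.dim A.X (2 * 2) 2 2 w ∧
          w ∈ weilClassesOf A φ 2 d} := by
    rw [Submodule.map_sup]
    refine sup_le_sup ?_ ?_
    · rintro _ ⟨y, hy, rfl⟩
      exact AbelianVariety.map_mem_divisorClassesSpan f hy
    · rw [Submodule.map_span, Submodule.span_le]
      rintro _ ⟨w, ⟨d, φ, hd, hφ, hwQ, hwH, hwW⟩, rfl⟩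
      have hw2 := AbelianVariety.mapsTo_hodgeClasses f 2 ⟨hwQ, hwH⟩
      refine Submodule.subset_span ⟨N ^ 2 * d, f ≫ φ ≫ g, Nat.mul_pos (pow_pos hN 2) hd,
        conj_comp_conj g f hgf hfg hφ, hw2.1, hw2.2, ?_⟩
      have hcomm : f ≫ (N • φ) = (f ≫ φ ≫ g) ≫ f := by
        simp only [Category.assoc, hgf, Preadditive.comp_nsmul, Category.comp_id]
      exact map_mem_weilClassesOf_of_comm hcomm (weilClassesOf_le_weilClassesOf_nsmul B φ 2 d N hwW)
  -- `f^* g^* c = N⁴ • c`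
  have hN4 : ((N : ℂ) ^ (2 * 2)) • c ∈ divisorClassesSpan A.X A.dim 2 ⊔
      Submodule.span ℂ {w : complexBetti A.X (2 * 2) | ∃ (d : ℕ) (φ : A ⟶ A), 0 < d ∧
        φ ≫ φ = -(d • 𝟙 A) ∧ IsRationalClass w ∧ IsOfHodgeType A.dim A.X (2 * 2) 2 2 w ∧
        w ∈ weilClassesOf A φ 2 d} := by
    rw [← complexBetti_map_map_of_comp_eq_nsmul_id hfg (2 * 2) c]
    exact hle ⟨_, hmem, rfl⟩
  have hN' : ((N : ℂ) ^ (2 * 2)) ≠ 0 := pow_ne_zero _ (Nat.cast_ne_zero.2 hN.ne')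
  have := Submodule.smul_mem _ (((N : ℂ) ^ (2 * 2))⁻¹) hN4
  rwa [smul_smul, inv_mul_cancel₀ hN', one_smul] at this

/-- **… AND TO THE TARGET** of an isogeny `f : B ⟶ A` (apply `of_isIsogeny` to a quasi-inverse, itself an isogeny).
[cite: vanGeemen1994HodgeAV, 3.6–3.7] [cite: MumfordAV1970, §19 Remark p. 169] -/
theorem IsCodimTwoDivisorWeilGenerated.of_isIsogeny' (hB : IsCodimTwoDivisorWeilGenerated B) {f : B ⟶ A}
    (hf : AbelianVariety.IsIsogeny f) : IsCodimTwoDivisorWeilGenerated A := by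
  obtain ⟨g, N, hN, hfg, hgf⟩ := AbelianVariety.IsIsogeny.exists_nsmul_inverse_holds hf
  have hg : AbelianVariety.IsIsogeny g :=
    AbelianVariety.isIsogeny_of_comp_eq_of_comp_eq
      (AbelianVariety.isIsogeny_nsmul_id_of_cast_ne_zero B N (Nat.cast_ne_zero.2 hN.ne'))
      (AbelianVariety.isIsogeny_nsmul_id_of_cast_ne_zero A N (Nat.cast_ne_zero.2 hN.ne')) hfg hgf
  exact hB.of_isIsogeny hg

/-- `B² ⊆ D² + Σ W_K` is an invariant of the isogeny class: `A ∼ B` form. [cite: vanGeemen1994HodgeAV, 3.6–3.7]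
[cite: MoonenZarhin1999LowDim, §5 (5.1)] -/
theorem IsCodimTwoDivisorWeilGenerated.of_isIsogenous (hB : IsCodimTwoDivisorWeilGenerated B)
    (hAB : AbelianVariety.IsIsogenous A B) : IsCodimTwoDivisorWeilGenerated A := by
  obtain ⟨f, hf⟩ := hAB
  exact hB.of_isIsogeny hf

/-- `B ∼ A` form. [cite: vanGeemen1994HodgeAV, 3.6–3.7] [cite: MoonenZarhin1999LowDim, §5 (5.1)] -/
theorem IsCodimTwoDivisorWeilGenerated.of_isIsogenous' (hB : IsCodimTwoDivisorWeilGenerated B)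
    (hBA : AbelianVariety.IsIsogenous B A) : IsCodimTwoDivisorWeilGenerated A := by
  obtain ⟨f, hf⟩ := hBA
  exact hB.of_isIsogeny' hf

/-- `B² ⊆ D² + Σ W_K` for `A` iff for `B`, when `A ∼ B`. [cite: vanGeemen1994HodgeAV, 3.6–3.7 (Lemma 3.7)] -/
theorem isCodimTwoDivisorWeilGenerated_iff_of_isIsogenous (hAB : AbelianVariety.IsIsogenous A B) :
    IsCodimTwoDivisorWeilGenerated A ↔ IsCodimTwoDivisorWeilGenerated B :=
  ⟨fun h => h.of_isIsogenous' hAB, fun h => h.of_isIsogenous hAB⟩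

/-! ### §3 Case (a1): `E_k × T` with `End⁰(T) = k` (Thm. 0.1 (1), §5 (5.3)) -/

/-- **CASE (a1) IN THE TREE'S R30 COORDINATES**: `B²(T × E) ⊆ D² + Σ W_K` for `T` a threefold with
`dim_ℚ End⁰(T) = 2`, `φ ≫ φ = -d` of multiplicity `1` at `μ₀ = ± i√d`, and `E` an elliptic curve with `χ ≫ χ = -d`
of multiplicity `1` at the same `μ₀` — the tree's `isDivisorWeilGenerated_prod_cmCurve_of_unitaryTwoOne`
(`B•(T × E_k) ⊆ D• + W_k`, «`W_k` is a subspace of `H¹(X₁,ℚ) ⊗ H³(X₂,ℚ)`») and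
`isWeilType_prod_cmCurve_of_unitaryTwoOne`, read through §1. [cite: MoonenZarhin1999LowDim, Thm. 0.1 (1) and §5 (5.3)]
[cite: vanGeemen1994HodgeAV, Thm. 6.12] -/
theorem isCodimTwoDivisorWeilGenerated_prod_cmCurve_of_unitaryTwoOne (hY3 : Y.dim = 3)
    (hY2 : Module.finrank ℚ Y.endAlgebra = 2) (φY : Y ⟶ Y) {d : ℕ} (hd : 0 < d) (hφY : φY ≫ φY = -(d • 𝟙 Y))
    {μ₀ : ℂ} (hμ₀ : μ₀ = Complex.I * (Real.sqrt d : ℂ) ∨ μ₀ = -(Complex.I * (Real.sqrt d : ℂ)))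
    (hmY : eigenMultiplicity Y φY μ₀ = 1) (hE1 : E.dim = 1) (χ : E ⟶ E) (hχ : χ ≫ χ = -(d • 𝟙 E))
    (hmE : eigenMultiplicity E χ μ₀ = 1) : IsCodimTwoDivisorWeilGenerated (Y.prod E) :=
  (isDivisorWeilGenerated_prod_cmCurve_of_unitaryTwoOne hY3 hY2 φY hd hφY hμ₀ hmY hE1 χ hχ hmE)
    |>.isCodimTwoDivisorWeilGenerated_of_isWeilType
      (isWeilType_prod_cmCurve_of_unitaryTwoOne hY3 φY hd hφY hμ₀ hmY hE1 χ hχ hmE)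

/-- … and for every `X` isogenous to such a `T × E`. [cite: MoonenZarhin1999LowDim, Thm. 0.1 (1) with case (a)]
[cite: vanGeemen1994HodgeAV, 3.6–3.7 and Thm. 6.12] -/
theorem isCodimTwoDivisorWeilGenerated_of_isIsogenous_unitaryTwoOne_prod_cmCurve (hY3 : Y.dim = 3)
    (hY2 : Module.finrank ℚ Y.endAlgebra = 2) (φY : Y ⟶ Y) {d : ℕ} (hd : 0 < d) (hφY : φY ≫ φY = -(d • 𝟙 Y))
    {μ₀ : ℂ} (hμ₀ : μ₀ = Complex.I * (Real.sqrt d : ℂ) ∨ μ₀ = -(Complex.I * (Real.sqrt d : ℂ)))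
    (hmY : eigenMultiplicity Y φY μ₀ = 1) (hE1 : E.dim = 1) (χ : E ⟶ E) (hχ : χ ≫ χ = -(d • 𝟙 E))
    (hmE : eigenMultiplicity E χ μ₀ = 1) (hX : AbelianVariety.IsIsogenous X (Y.prod E)) :
    IsCodimTwoDivisorWeilGenerated X :=
  (isCodimTwoDivisorWeilGenerated_prod_cmCurve_of_unitaryTwoOne hY3 hY2 φY hd hφY hμ₀ hmY hE1 χ hχ hmE).of_isIsogenous
    hX

/-- **CASE (a1) WITH THE PRINTED HYPOTHESES.** `E` an elliptic curve with complex multiplication `χ ≫ χ = -d`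
(`d > 0`), `T` a simple abelian threefold NOT of CM type, `j : End⁰(E) →+* End⁰(T)` («there exists an embedding
`k ↪ End⁰(X₂)`»): then `B²(E × T) ⊆ D² + Σ W_K`. By (5.3) and `T` not CM, `dim_ℚ End⁰(T) = 2`
(`finrank_endAlgebra_eq_two_or_isOfCMType_of_dim_eq_three_of_ringHom`); the data of the R30 theorem are PRODUCED
from `j`: an honest `φ : T ⟶ T` with `φ ≫ φ = -(M²d) = (Mχ) ≫ (Mχ)` (`exists_hom_comp_self_eq_neg_of_ringHom`),
multiplicities `{1, 2}` of `± iM√d` on `H^{1,0}(T)` (both positive on a simple `T`, Shimura — the tree's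
`AbelianVariety.eigenMultiplicity_pos_of_isSimple` —, sum `3`), and the sign of `± Mχ` matched on `E`
(`eigenMultiplicity_neg`); then `T × E ∼ E × T` (§2). [cite: MoonenZarhin1999LowDim, Thm. 0.1 (1) with case (a) and §5 (5.3)]
[cite: vanGeemen1994HodgeAV, Thm. 6.12] -/
theorem isCodimTwoDivisorWeilGenerated_cmCurve_prod_simpleThreefold_of_not_isOfCMType (hE : E.dim = 1) (χ : E ⟶ E)
    {d : ℕ} (hd : 0 < d) (hχ : χ ≫ χ = -(d • 𝟙 E)) (hTs : T.IsSimple) (hT3 : T.dim = 3) (hTcm : ¬ IsOfCMType T)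
    (j : E.endAlgebra →+* T.endAlgebra) : IsCodimTwoDivisorWeilGenerated (E.prod T) := by
  have h2 : Module.finrank ℚ T.endAlgebra = 2 :=
    (finrank_endAlgebra_eq_two_or_isOfCMType_of_dim_eq_three_of_ringHom hTs hT3 hd hχ j).resolve_right hTcm
  obtain ⟨φ, M, hM, hφ, hχM, -⟩ := exists_hom_comp_self_eq_neg_of_ringHom hχ j
  have hdM : 0 < M ^ 2 * d := Nat.mul_pos (pow_pos hM 2) hd
  have hsum := eigenMultiplicity_add_eigenMultiplicity_neg_eq_dim T φ hdM hφ
  rw [hT3] at hsum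
  obtain ⟨ha, hb⟩ := AbelianVariety.eigenMultiplicity_pos_of_isSimple T hTs φ hdM hφ (by omega)
  have hsum₁ := eigenMultiplicity_add_eigenMultiplicity_neg_eq_dim E (M • χ) hdM hχM
  rw [hE] at hsum₁
  have hχ' : (-(M • χ)) ≫ (-(M • χ)) = -((M ^ 2 * d) • 𝟙 E) := by
    rw [Preadditive.neg_comp, Preadditive.comp_neg, neg_neg, hχM]
  -- given an eigenvalue `μ₀` of multiplicity `1` for `φ`, match the curve's sign and conclude on `T × E ∼ E × T`
  have key : ∀ μ₀ : ℂ, (μ₀ = Complex.I * (Real.sqrt (M ^ 2 * d : ℕ) : ℂ) ∨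
      μ₀ = -(Complex.I * (Real.sqrt (M ^ 2 * d : ℕ) : ℂ))) → eigenMultiplicity T φ μ₀ = 1 →
      eigenMultiplicity E (M • χ) μ₀ + eigenMultiplicity E (M • χ) (-μ₀) = 1 →
      IsCodimTwoDivisorWeilGenerated (E.prod T) := by
    intro μ₀ hμ₀ hmT hs₁
    refine IsCodimTwoDivisorWeilGenerated.of_isIsogenous ?_ (isIsogenous_prod_swap E T)
    rcases Nat.eq_zero_or_pos (eigenMultiplicity E (M • χ) μ₀) with h0 | hpos
    · have hm₁ : eigenMultiplicity E (-(M • χ)) μ₀ = 1 := by rw [eigenMultiplicity_neg]; omega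
      exact isCodimTwoDivisorWeilGenerated_prod_cmCurve_of_unitaryTwoOne hT3 h2 φ hdM hφ hμ₀ hmT hE (-(M • χ)) hχ'
        hm₁
    · exact isCodimTwoDivisorWeilGenerated_prod_cmCurve_of_unitaryTwoOne hT3 h2 φ hdM hφ hμ₀ hmT hE (M • χ) hχM
        (by omega)
  rcases (show eigenMultiplicity T φ (Complex.I * (Real.sqrt (M ^ 2 * d : ℕ) : ℂ)) = 1 ∨
      eigenMultiplicity T φ (-(Complex.I * (Real.sqrt (M ^ 2 * d : ℕ) : ℂ))) = 1 by omega) with h1 | h1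
  · exact key _ (Or.inl rfl) h1 hsum₁
  · exact key _ (Or.inr rfl) h1 (by rw [neg_neg, add_comm]; exact hsum₁)

/-- **CASE (a1) EXACTLY AS PRINTED, FOR THE NON-CM MEMBERS: every `X` isogenous to `E × T`** with `E` an elliptic curve
of CM type (the cell's `IsOfCMType E`; its complex multiplication from the tree's `exists_hom_comp_self_eq_neg_of_cmCurve`),
`T` a simple threefold not of CM type and `Nonempty (End⁰(E) →+* End⁰(T))`, satisfies `B²(X) ⊆ D²(X) + Σ W_K` —
UNCONDITIONALLY. [cite: MoonenZarhin1999LowDim, Thm. 0.1 (1) with case (a) and §5 (5.1), (5.3)]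
[cite: vanGeemen1994HodgeAV, Lemma 3.7 and Thm. 6.12] -/
theorem isCodimTwoDivisorWeilGenerated_of_isIsogenous_caseA_of_not_isOfCMType
    (hX : AbelianVariety.IsIsogenous (E.prod T) X) (hE : E.dim = 1) (hEcm : IsOfCMType E) (hTs : T.IsSimple)
    (hT3 : T.dim = 3) (hTcm : ¬ IsOfCMType T) (hj : Nonempty (E.endAlgebra →+* T.endAlgebra)) :
    IsCodimTwoDivisorWeilGenerated X := by
  obtain ⟨j⟩ := hj
  obtain ⟨χ, d, hd, hχ⟩ := exists_hom_comp_self_eq_neg_of_cmCurve hE hEcm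
  exact (isCodimTwoDivisorWeilGenerated_cmCurve_prod_simpleThreefold_of_not_isOfCMType hE χ hd hχ hTs hT3 hTcm
    j).of_isIsogenous' hX

/-! ### §4 Every non-simple fourfold not of CM type (Thm. 0.1 (1) case (a1) ∪ Thm. 0.1 (4), §5 (5.3)–(5.4)) -/

/-- **MOONEN–ZARHIN Thm. 0.1, CODIMENSION 2, FOR EVERY NON-SIMPLE COMPLEX ABELIAN FOURFOLD NOT OF CM TYPE —
UNCONDITIONAL: `B²(X) ⊆ D²(X) + Σ_K W_K`.** Outside case (a) (in its isogeny form with `T` not of CM type) the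
fourfold is stably nondegenerate — Thm. 0.1 (4), the tree's
`isStablyNondegenerate_of_dim_eq_four_of_not_isSimple_of_not_isOfCMType'` ((5.4)) —, so `B = D`; in case (a) with `T`
not of CM type, §3. (A CM member `E × T` of case (a), `T` of CM type, would make `X` of CM type.) This is the non-CM
non-simple slice of the named fact `MoonenZarhin1999_codimTwoHodgeClasses_abelianFourfold`, PROVED.
[cite: MoonenZarhin1999LowDim, Thm. 0.1 (1), (4) with case (a) and §5 (5.3)–(5.4)]
[cite: MumfordAV1970, §19 Thm. 1 (pp. 173–174)] -/
theorem isCodimTwoDivisorWeilGenerated_of_dim_eq_four_of_not_isSimple_of_not_isOfCMType (hX4 : X.dim = 4)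
    (hX : ¬ X.IsSimple) (hcm : ¬ IsOfCMType X) : IsCodimTwoDivisorWeilGenerated X := by
  by_cases hna' : ∀ E T : AbelianVariety ℂ, E.dim = 1 → T.dim = 3 → T.IsSimple → IsOfCMType E → ¬ IsOfCMType T →
      AbelianVariety.IsIsogenous (E.prod T) X → IsEmpty (E.endAlgebra →+* T.endAlgebra)
  · exact (isStablyNondegenerate_of_dim_eq_four_of_not_isSimple_of_not_isOfCMType' hX4 hX hcm
      hna').isCodimTwoDivisorWeilGenerated
  · simp only [not_forall, not_isEmpty_iff, exists_prop] at hna'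
    obtain ⟨E, T, hE, hT3, hTs, hEcm, hTcm, hiso, hne⟩ := hna'
    exact isCodimTwoDivisorWeilGenerated_of_isIsogenous_caseA_of_not_isOfCMType hiso hE hEcm hTs hT3 hTcm hne

/-- **The Hodge conjecture for every non-simple complex abelian fourfold not of CM type, GRANTED MARKMAN'S FOURFOLD
THEOREM ALONE** (hypothesis `hMark`; §4 + §1). (The Summit file `Ring2/LowDimensionHodgeOfMarkman` has this for all
non-simple fourfolds; recorded here in the Literature layer through the class statement.)
[cite: MoonenZarhin1999LowDim, Thm. 0.1 (1), (4)] [cite: Markman2025SurveySecant, §1.1 and Cor. 1.3] -/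
theorem hodgeConjectureFor_of_dim_eq_four_of_not_isSimple_of_not_isOfCMType_of_markman
    (hMark : Markman2025_weilClasses_algebraic_abelianFourfold) (hX4 : X.dim = 4) (hX : ¬ X.IsSimple)
    (hcm : ¬ IsOfCMType X) : HodgeConjectureFor X.dim X.X :=
  (isCodimTwoDivisorWeilGenerated_of_dim_eq_four_of_not_isSimple_of_not_isOfCMType hX4 hX hcm).hodgeConjectureFor_of_markman
    hMark hX4

/-- **What the named fact still carries beyond this file and the CM calculus**: granted `B² ⊆ D² + Σ W_K` for the
fourfolds of CM type (Summit-side, CorCM) and for the SIMPLE fourfolds not of CM type (Moonen–Zarhin 1995), the fact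
`MoonenZarhin1999_codimTwoHodgeClasses_abelianFourfold` follows. [cite: MoonenZarhin1999LowDim, Thm. 0.1 and §5 (5.1)] -/
theorem moonenZarhin1999_codimTwoHodgeClasses_abelianFourfold_of_isOfCMType_of_isSimple
    (hCM : ∀ A : AbelianVariety ℂ, A.dim = 4 → IsOfCMType A → IsCodimTwoDivisorWeilGenerated A)
    (hS : ∀ A : AbelianVariety ℂ, A.dim = 4 → A.IsSimple → ¬ IsOfCMType A → IsCodimTwoDivisorWeilGenerated A) :
    MoonenZarhin1999_codimTwoHodgeClasses_abelianFourfold := by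
  intro A hA
  by_cases hcm : IsOfCMType A
  · exact hCM A hA hcm
  by_cases hs : A.IsSimple
  · exact hS A hA hs hcm
  · exact isCodimTwoDivisorWeilGenerated_of_dim_eq_four_of_not_isSimple_of_not_isOfCMType hA hs hcm

end Literature.AlgebraicGeometry.HodgeTheory

end
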